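import Summits.Parity.GeneralizedHardyLittlewood.Theses.LiouvilleShiftedTables
import Summits.Parity.GeneralizedHardyLittlewood.Theorems.TableChowla.Negative.TableChowlaDegenerateWindows

/-!
# `TableChowla` (stmt-Parity-14270): tightness floors and three FALSE strengthenings

Negative lemmas for the crux `LiouvilleShiftedTables.TableChowla` (cdisprove seat), continuing
`TableChowlaFalseWithoutShiftNeZero` and `TableChowlaDegenerateWindows`:
* TIGHTNESS — `rows_mul_cols_sq_le_momentN` (`T ≥ rows·B² ≍ x²/A`, the diagonal: no bound
  `o(x²/A)` is possible and the whole `(log x)^{-C}` saving must come from the pairs `a ≠ a'`),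
  the exact row/column duality `momentN_eq_colMoment` (`‖MMᵀ‖_F = ‖MᵀM‖_F`: the crux is equally a
  fourth-moment statement about SHORT column correlations of length `≍ A`), and the column floor
  `cols_mul_rows_sq_le_momentN` (`T ≥ B·rows² ≍ xA`, the random-model size);
* FALSE STRENGTHENINGS — `not_tableChowlaUniformPowerSaving` (no saving `x^{2-η}` with `η`
  uniform in `δ`: the diagonal forces `η ≤ δ`), `not_tableChowlaThresholdUniformInC` (one
  threshold `x₀` for all `C` is impossible: the order `∀ C ∃ x₀` is essential),
  `not_tableChowlaPolylogWindow` (a polylogarithmic lower window `(log x)^K ≤ A` fails for every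
  `K` at `C = K + 1`: the window's lower end must be super-polylogarithmic). [folklore]
-/

namespace Summit.Parity.GeneralizedHardyLittlewood.Theorems.TableChowla.Negative

open Finset Real ArithmeticFunction
open Summit.Parity.GeneralizedHardyLittlewood.Theses

noncomputable section

variable {f : ℕ → ℝ} {c : ℤ} {A₁ A₂ B : ℕ}

/-- DIAGONAL FLOOR: for a `±1`-valued `f`, once every argument `ab + c` is positive the moment is at
least `rows · B² = (A₂ - A₁) · B²` (`≍ x²/A ≥ x^{5/3-δ}` in the crux): the whole `(log x)^{-C}`
saving must come from the off-diagonal pairs `a ≠ a'`, and no bound `o(x²/A)` is possible. -/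
theorem rows_mul_cols_sq_le_momentN (hf : ∀ n, n ≠ 0 → f n ^ 2 = 1)
    (hpos : ∀ a ∈ Ioc A₁ A₂, ∀ b ∈ Icc 1 B, 1 ≤ (a : ℤ) * b + c) :
    ((A₂ - A₁ : ℕ) : ℝ) * (B : ℝ) ^ 2 ≤ momentN f c A₁ A₂ B := by
  calc ((A₂ - A₁ : ℕ) : ℝ) * (B : ℝ) ^ 2 = ∑ _a ∈ Ioc A₁ A₂, (B : ℝ) ^ 2 := by simp [Nat.card_Ioc]
    _ = ∑ a ∈ Ioc A₁ A₂, rowCorr f c B a a ^ 2 :=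
        sum_congr rfl fun a ha => by rw [rowCorr_self_eq hf (hpos a ha)]
    _ ≤ momentN f c A₁ A₂ B := diag_le_momentN

/-- COLUMN DUALITY `‖M Mᵀ‖_F² = ‖Mᵀ M‖_F²`: the moment is equally the fourth moment of the
COLUMN correlations `∑_{a} f(ab+c) f(ab'+c)` — short sums of length `≍ A` over `a`. -/
theorem momentN_eq_colMoment :
    momentN f c A₁ A₂ B = ∑ b ∈ Icc 1 B, ∑ b' ∈ Icc 1 B,
      (∑ a ∈ Ioc A₁ A₂, f (Int.toNat ((a : ℤ) * b + c)) * f (Int.toNat ((a : ℤ) * b' + c))) ^ 2 := by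
  unfold momentN rowCorr
  simp_rw [sq, sum_mul_sum]
  -- bubble the `Icc` (column) sums outside the `Ioc` (row) sums; both sides are one quadruple sum
  simp_rw [sum_comm (s := Ioc A₁ A₂) (t := Icc 1 B)]
  refine sum_congr rfl fun b _ => sum_congr rfl fun b' _ => sum_congr rfl fun a _ =>
    sum_congr rfl fun a' _ => ?_
  ring

/-- COLUMN FLOOR (dual, via `momentN_eq_colMoment`): for a `±1`-valued `f` the moment is also at
least `B · rows²` (`≍ x·A`, the random-model size of the off-diagonal part): even a perfectly
"random" table cannot do better than `x·A`. -/
theorem cols_mul_rows_sq_le_momentN (hf : ∀ n, n ≠ 0 → f n ^ 2 = 1)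
    (hpos : ∀ a ∈ Ioc A₁ A₂, ∀ b ∈ Icc 1 B, 1 ≤ (a : ℤ) * b + c) :
    (B : ℝ) * ((A₂ - A₁ : ℕ) : ℝ) ^ 2 ≤ momentN f c A₁ A₂ B := by
  rw [momentN_eq_colMoment]
  have hcol : ∀ b ∈ Icc 1 B,
      (∑ a ∈ Ioc A₁ A₂, f (Int.toNat ((a : ℤ) * b + c)) * f (Int.toNat ((a : ℤ) * b + c))) =
        ((A₂ - A₁ : ℕ) : ℝ) := by
    intro b hb
    calc (∑ a ∈ Ioc A₁ A₂, f (Int.toNat ((a : ℤ) * b + c)) * f (Int.toNat ((a : ℤ) * b + c)))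
          = ∑ _a ∈ Ioc A₁ A₂, (1 : ℝ) := by
            refine sum_congr rfl fun a ha => ?_
            rw [← sq]
            apply hf
            intro h0
            rw [Int.toNat_eq_zero] at h0
            linarith [hpos a ha b hb]
      _ = ((A₂ - A₁ : ℕ) : ℝ) := by simp [Nat.card_Ioc]
  set G : ℕ → ℕ → ℝ := fun b b' =>
    ∑ a ∈ Ioc A₁ A₂, f (Int.toNat ((a : ℤ) * b + c)) * f (Int.toNat ((a : ℤ) * b' + c)) with hG
  show (B : ℝ) * ((A₂ - A₁ : ℕ) : ℝ) ^ 2 ≤ ∑ b ∈ Icc 1 B, ∑ b' ∈ Icc 1 B, G b b' ^ 2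
  calc (B : ℝ) * ((A₂ - A₁ : ℕ) : ℝ) ^ 2 = ∑ _b ∈ Icc 1 B, ((A₂ - A₁ : ℕ) : ℝ) ^ 2 := by simp
    _ = ∑ b ∈ Icc 1 B, G b b ^ 2 := sum_congr rfl fun b hb => by rw [hG]; dsimp only; rw [hcol b hb]
    _ ≤ ∑ b ∈ Icc 1 B, ∑ b' ∈ Icc 1 B, G b b' ^ 2 := by
        refine sum_le_sum fun b hb => ?_
        exact single_le_sum (f := fun b' => G b b' ^ 2) (fun _ _ => sq_nonneg _) hb

/-- In the standard specialisation with `c = 1`: the λ-moment at `x = m^k`, `A = m` is at least the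
diagonal `m · m^{2(k-1)}`. -/
theorem diag_le_moment_pow {k m : ℕ} (hk : 1 ≤ k) (hm : m ≠ 0) :
    (m : ℝ) * ((m : ℝ) ^ (k - 1)) ^ 2 ≤ moment lam 1 ((m : ℝ) ^ k) m := by
  rw [moment_pow lam 1 hk hm]
  have h := rows_mul_cols_sq_le_momentN (f := lam) (c := 1) (A₁ := m) (A₂ := 2 * m) (B := m ^ (k - 1))
    lam_sq' (fun a _ b _ => by nlinarith [Nat.cast_nonneg (α := ℤ) a, Nat.cast_nonneg (α := ℤ) b])
  rw [show 2 * m - m = m by omega] at h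
  exact_mod_cast h

/-- STRENGTHENING 1 — a power saving `x^{2-η}` with `η` uniform in `δ`. -/
def TableChowlaUniformPowerSaving : Prop :=
  ∃ η : ℝ, 0 < η ∧ ∀ c : ℤ, c ≠ 0 → ∀ δ : ℝ, 0 < δ → δ ≤ 1 / 12 → ∃ x₀ : ℝ, ∀ x : ℝ, x₀ ≤ x →
    ∀ A : ℝ, x ^ δ ≤ A → A ≤ x ^ (1 / 3 + δ) → moment lam c x A ≤ x ^ (2 - η)

/-- FALSE: the diagonal `≍ x^{2-δ}` beats `x^{2-η}` as soon as `δ < η` (witness `δ = 1/k`,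
`k > max(12, 1/η)`, `x = m^k`, `A = m`). Any power saving must degrade with the window, `η ≤ δ`;
the crux's `(log x)^{-C}` form is the uniform-in-`δ` shape that survives this. -/
theorem not_tableChowlaUniformPowerSaving : ¬ TableChowlaUniformPowerSaving := by
  rintro ⟨η, hη, h⟩
  obtain ⟨k, hk⟩ := exists_nat_gt (max 12 (1 / η))
  have hk12 : (12 : ℝ) < k := lt_of_le_of_lt (le_max_left _ _) hk
  have hkη : 1 / η < k := lt_of_le_of_lt (le_max_right _ _) hk
  have hkpos : (0 : ℝ) < k := by linarith
  have hk1 : 1 ≤ k := by exact_mod_cast (show (1 : ℝ) ≤ k by linarith)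
  have hkη' : 1 < (k : ℝ) * η := by
    have := (div_lt_iff₀ hη).mp hkη; linarith
  obtain ⟨x₀, hx₀⟩ := h 1 one_ne_zero (1 / k) (by positivity)
    (by rw [div_le_div_iff_of_pos_left one_pos hkpos (by norm_num)]; exact hk12.le)
  obtain ⟨m, hm⟩ := exists_nat_ge (max x₀ 2)
  have hm2 : (2 : ℝ) ≤ m := le_trans (le_max_right _ _) hm
  have hmx : x₀ ≤ m := le_trans (le_max_left _ _) hm
  have hm1 : (1 : ℝ) ≤ m := by linarith
  have hm1' : 1 ≤ m := by exact_mod_cast hm1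
  have hm0 : m ≠ 0 := by omega
  have hmpos : (0 : ℝ) < m := by linarith
  have hxx₀ : x₀ ≤ (m : ℝ) ^ k := hmx.trans (le_self_pow₀ hm1 (by omega))
  obtain ⟨hw1, hw2⟩ := window_pow (k := k) (by omega) hm1'
  have key := hx₀ ((m : ℝ) ^ k) hxx₀ m hw1 hw2
  have hdiag := diag_le_moment_pow hk1 hm0
  -- x^(2-η) = x² / x^η and x^η = m^(kη) > m
  have hxpos : (0 : ℝ) < (m : ℝ) ^ k := by positivity
  have hsplit : ((m : ℝ) ^ k) ^ (2 - η) = ((m : ℝ) ^ k) ^ 2 / ((m : ℝ) ^ k) ^ η := by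
    rw [Real.rpow_sub hxpos, Real.rpow_two]
  have hη_big : (m : ℝ) < ((m : ℝ) ^ k) ^ η := by
    rw [← Real.rpow_natCast_mul hmpos.le]
    calc (m : ℝ) = (m : ℝ) ^ (1 : ℝ) := (Real.rpow_one _).symm
      _ < (m : ℝ) ^ ((k : ℝ) * η) := Real.rpow_lt_rpow_of_exponent_lt (by linarith) hkη'
  have hpk : ((m : ℝ) ^ k) ^ 2 = (m : ℝ) * ((m : ℝ) ^ (k - 1)) ^ 2 * m := by
    have : (m : ℝ) ^ k = (m : ℝ) ^ (k - 1) * m := by rw [← pow_succ, Nat.sub_add_cancel hk1]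
    rw [this]; ring
  -- chain: diag ≤ T ≤ x²/x^η < x²/m = diag
  have hlt : ((m : ℝ) ^ k) ^ 2 / ((m : ℝ) ^ k) ^ η < (m : ℝ) * ((m : ℝ) ^ (k - 1)) ^ 2 := by
    rw [div_lt_iff₀ (by positivity), hpk]
    exact mul_lt_mul_of_pos_left hη_big (by positivity)
  linarith [hsplit ▸ key]

/-- STRENGTHENING 2 — one threshold `x₀` serving every log-power `C` (`∃ x₀ ∀ C`, i.e. a
super-polylogarithmic saving). -/
def TableChowlaThresholdUniformInC : Prop :=
  ∀ c : ℤ, c ≠ 0 → ∀ δ : ℝ, 0 < δ → δ ≤ 1 / 12 → ∃ x₀ : ℝ, ∀ C : ℝ, 0 < C → ∀ x : ℝ, x₀ ≤ x →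
    ∀ A : ℝ, x ^ δ ≤ A → A ≤ x ^ (1 / 3 + δ) → moment lam c x A ≤ x ^ 2 / Real.log x ^ C

/-- FALSE: at fixed `x` the right side `x²/(log x)^C → 0` as `C → ∞` while the diagonal is `≥ x²/A`;
(witness `x = m¹²`, `A = m`, `C = m`: `(12 log m)^m ≥ 2^m > m`). The quantifier order `∀ C ∃ x₀` of
the crux is essential — the saving is NOT claimed beyond every fixed log-power. -/
theorem not_tableChowlaThresholdUniformInC : ¬ TableChowlaThresholdUniformInC := by
  intro h
  obtain ⟨x₀, hx₀⟩ := h 1 one_ne_zero (1 / 12) (by norm_num) le_rfl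
  obtain ⟨m, hm⟩ := exists_nat_ge (max x₀ 2)
  have hm2 : (2 : ℝ) ≤ m := le_trans (le_max_right _ _) hm
  have hmx : x₀ ≤ m := le_trans (le_max_left _ _) hm
  have hm1 : (1 : ℝ) ≤ m := by linarith
  have hm1' : 1 ≤ m := by exact_mod_cast hm1
  have hm0 : m ≠ 0 := by omega
  have hmpos : (0 : ℝ) < m := by linarith
  have hxx₀ : x₀ ≤ (m : ℝ) ^ 12 := hmx.trans (le_self_pow₀ hm1 (by norm_num))
  obtain ⟨hw1, hw2⟩ := window_pow (k := 12) (by norm_num) hm1'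
  have key := hx₀ m hmpos ((m : ℝ) ^ 12) hxx₀ m (by exact_mod_cast hw1) (by exact_mod_cast hw2)
  have hdiag := diag_le_moment_pow (k := 12) (by norm_num) hm0
  rw [Real.log_pow, Nat.cast_ofNat, Real.rpow_natCast] at key
  -- (12 log m)^m ≥ 2^m > m
  have hlog2 : (2 : ℝ) ≤ 12 * Real.log m := by
    have := Real.log_le_log (by norm_num) hm2
    have := log_two_gt_half
    linarith
  have hbig : (m : ℝ) < (12 * Real.log m) ^ m := by
    calc (m : ℝ) < (2 : ℝ) ^ m := by exact_mod_cast Nat.lt_two_pow_self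
      _ ≤ (12 * Real.log m) ^ m := pow_le_pow_left₀ (by norm_num) hlog2 m
  have hpk : ((m : ℝ) ^ 12) ^ 2 = (m : ℝ) * ((m : ℝ) ^ (12 - 1)) ^ 2 * m := by ring
  have hlt : ((m : ℝ) ^ 12) ^ 2 / (12 * Real.log m) ^ m < (m : ℝ) * ((m : ℝ) ^ (12 - 1)) ^ 2 := by
    rw [div_lt_iff₀ (by positivity), hpk]
    exact mul_lt_mul_of_pos_left hbig (by positivity)
  exact absurd (lt_of_le_of_lt (hdiag.trans key) hlt) (lt_irrefl _)

/-- STRENGTHENING 3 — a POLYLOGARITHMIC lower window `(log x)^K ≤ A ≤ x^{1/3}`. -/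
def TableChowlaPolylogWindow (K : ℕ) : Prop :=
  ∀ c : ℤ, c ≠ 0 → ∀ C : ℝ, 0 < C → ∃ x₀ : ℝ, ∀ x : ℝ, x₀ ≤ x →
    ∀ A : ℝ, Real.log x ^ K ≤ A → A ≤ x ^ ((1 : ℝ) / 3) → moment lam c x A ≤ x ^ 2 / Real.log x ^ C

/-- FALSE for every `K` (witness `x = e^m`, `A = m^K`, `C = K + 1`: the diagonal `≍ x²/A = x²/(log x)^K`
beats `x²/(log x)^{K+1}`). Under the `∀ C` form the lower end of the window must be
super-polylogarithmic in `x`: the power window `x^δ` is forced up to that, and any split of the crux by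
ranges of `A` must keep `A ≥ exp((log x)^{θ})`-type lower ends, never `(log x)^K`. -/
theorem not_tableChowlaPolylogWindow (K : ℕ) : ¬ TableChowlaPolylogWindow K := by
  intro h
  obtain ⟨x₀, hx₀⟩ := h 1 one_ne_zero (K + 1) (by positivity)
  obtain ⟨m, hm⟩ := exists_nat_ge (max x₀ ((3 : ℝ) ^ (K + 1) * (K + 1).factorial + 5))
  have hmx : x₀ ≤ m := le_trans (le_max_left _ _) hm
  have hmF : (3 : ℝ) ^ (K + 1) * (K + 1).factorial + 5 ≤ m := le_trans (le_max_right _ _) hm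
  have hfac1 : (1 : ℝ) ≤ (K + 1).factorial := by exact_mod_cast Nat.one_le_iff_ne_zero.mpr (Nat.factorial_ne_zero _)
  have h3K : (3 : ℝ) ≤ (3 : ℝ) ^ (K + 1) := by
    calc (3 : ℝ) = 3 ^ 1 := by norm_num
      _ ≤ 3 ^ (K + 1) := pow_le_pow_right₀ (by norm_num) (by omega)
  have hm5 : (5 : ℝ) ≤ m := by nlinarith
  have hmpos : (0 : ℝ) < m := by linarith
  -- the two growth facts, from `x^n/n! ≤ e^x`
  have hF1 : (m : ℝ) ^ K ≤ Real.exp (m / 3) := by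
    have P := Real.pow_div_factorial_le_exp ((m : ℝ) / 3) (by positivity) (K + 1)
    rw [div_le_iff₀ (by positivity), div_pow] at P
    -- P : m^(K+1) / 3^(K+1) ≤ exp (m/3) * (K+1)!
    rw [div_le_iff₀ (by positivity)] at P
    have hstep : (3 : ℝ) ^ (K + 1) * (K + 1).factorial * (m : ℝ) ^ K ≤ (m : ℝ) ^ (K + 1) := by
      rw [show (m : ℝ) ^ (K + 1) = (m : ℝ) ^ K * m from pow_succ _ _]
      have : (3 : ℝ) ^ (K + 1) * (K + 1).factorial ≤ m := by linarith
      nlinarith [mul_le_mul_of_nonneg_left this (pow_nonneg hmpos.le K)]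
    have hpos3 : (0 : ℝ) < (3 : ℝ) ^ (K + 1) * (K + 1).factorial := by positivity
    nlinarith [Real.exp_pos ((m : ℝ) / 3)]
  have hF2 : 2 * (m : ℝ) ^ K ≤ Real.exp m := by
    have P := Real.pow_div_factorial_le_exp (m : ℝ) hmpos.le (K + 1)
    rw [div_le_iff₀ (by positivity)] at P
    have hstep : 2 * (K + 1).factorial * (m : ℝ) ^ K ≤ (m : ℝ) ^ (K + 1) := by
      rw [show (m : ℝ) ^ (K + 1) = (m : ℝ) ^ K * m from pow_succ _ _]
      have : 2 * ((K + 1).factorial : ℝ) ≤ m := by nlinarith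
      nlinarith [mul_le_mul_of_nonneg_left this (pow_nonneg hmpos.le K)]
    nlinarith [Real.exp_pos (m : ℝ)]
  -- the specialisation x = e^m, A = M := m^K
  set x : ℝ := Real.exp m with hxdef
  have hxpos : 0 < x := Real.exp_pos _
  have hlogx : Real.log x = m := Real.log_exp _
  have hxx₀ : x₀ ≤ x := hmx.trans ((by linarith : (m : ℝ) ≤ m + 1).trans (Real.add_one_le_exp _))
  set M : ℕ := m ^ K with hMdef
  have hMreal : (M : ℝ) = (m : ℝ) ^ K := by rw [hMdef]; push_cast; rfl
  have hMpos : (0 : ℝ) < M := by rw [hMreal]; positivity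
  have hM0 : M ≠ 0 := by exact_mod_cast hMpos.ne'
  have hw1 : Real.log x ^ K ≤ (M : ℝ) := by rw [hlogx, hMreal]
  have hw2 : (M : ℝ) ≤ x ^ ((1 : ℝ) / 3) := by
    rw [hMreal, hxdef, ← Real.exp_mul, show (m : ℝ) * (1 / 3) = m / 3 by ring]
    exact hF1
  have key := hx₀ x hxx₀ M hw1 hw2
  rw [hlogx, show ((K : ℝ) + 1) = ((K + 1 : ℕ) : ℝ) by push_cast; ring, Real.rpow_natCast] at key
  -- the moment at (x, M): rows (M, 2M], B = ⌊x/M⌋ columns; diagonal floor M · B²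
  have hmom : moment lam 1 x M = momentN lam 1 M (2 * M) ⌊x / M⌋₊ := by
    unfold moment; rw [Nat.floor_natCast, floor_two_mul_natCast]
  have hdiag := rows_mul_cols_sq_le_momentN (f := lam) (c := 1) (A₁ := M) (A₂ := 2 * M) (B := ⌊x / M⌋₊)
    lam_sq' (fun a _ b _ => by nlinarith [Nat.cast_nonneg (α := ℤ) a, Nat.cast_nonneg (α := ℤ) b])
  rw [show 2 * M - M = M by omega, ← hmom] at hdiag
  -- B ≥ x/(2M)
  set Bn : ℕ := ⌊x / M⌋₊ with hBdef
  have hB1 : x / M - 1 < Bn := by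
    have := Nat.lt_floor_add_one (x / (M : ℝ))
    rw [hBdef]; linarith
  have hxM : 2 ≤ x / M := by
    rw [le_div_iff₀ hMpos, hMreal]; exact hF2
  have hB2 : x / (2 * M) ≤ Bn := by
    have : x / (2 * M) = x / M - x / M / 2 := by field_simp; ring
    rw [this]; linarith
  have hBpos : (0 : ℝ) < Bn := lt_of_lt_of_le (by positivity) hB2
  -- diag ≥ x²/(4M) > x²/(m M) = RHS
  have hlow : x ^ 2 / (4 * M) ≤ (M : ℝ) * (Bn : ℝ) ^ 2 := by
    have h1 : x ^ 2 / (4 * M) = M * (x / (2 * M)) ^ 2 := by field_simp; ring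
    rw [h1]
    exact mul_le_mul_of_nonneg_left (pow_le_pow_left₀ (by positivity) hB2 2) hMpos.le
  have hhigh : x ^ 2 / (m : ℝ) ^ (K + 1) < x ^ 2 / (4 * M) := by
    apply div_lt_div_of_pos_left (by positivity) (by positivity)
    rw [pow_succ, ← hMreal]
    nlinarith
  linarith

end

end Summit.Parity.GeneralizedHardyLittlewood.Theorems.TableChowla.Negative
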